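import Literature.Computability.Complexity.OccurrenceObstructionsIPProofs
import Literature.Computability.Complexity.OccurrenceObstructionsIPSemigroup
import Literature.NumberTheory.DiophantineGeometry.KroneckerMonotone
import HarnessLib

/-!
# Ikenmeyer–Panova 2017 Thm. 2.1 / Manivel 2011 Thm. 1 as an EQUALITY: the rectangular Kronecker
# coefficient `g(λ♯(m+j), (m+j)×d, (m+j)×d)` is non-decreasing in `j`, and constant for `|λ̄| ≤ m`

Sibling proofs file of `OccurrenceObstructionsIP.lean` / `OccurrenceObstructionsIPProofs.lean` (tree
letters: `λ ⊢ m·d`, row lift `λ♯(m+j) = λ + (jd)` = `rowLift λ j`, body size `|λ̄| = bodySize λ`).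

The tree had the UPPER half of Manivel's stability: `kroneckerCoeff_rowLift_succ_le` and
`kroneckerCoeff_rowLift_le` — for `|λ̄| ≤ m`, `g(λ♯(m+j), (m+j)×d, (m+j)×d) ≤ g(λ, m×d, m×d)`.  This file
adds the LOWER half, which holds WITHOUT any hypothesis on the body, from the monotonicity of the
Kronecker coefficients under the semigroup operation (`kroneckerCoeff_le_of_ofPartition_add`,
`KroneckerMonotone.lean`) and the positive one-row triple `((d), 1^d, 1^d)` in the transposed
orientation:

* `kroneckerCoeff_rowLift_succ_ge` — `g(λ♯(m+j), …) ≤ g(λ♯(m+j+1), …)` for every `j`;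
* `kroneckerCoeff_le_kroneckerCoeff_rowLift` — `g(λ, m×d, m×d) ≤ g(λ♯(m+j), (m+j)×d, (m+j)×d)` for every `j`;
* **`kroneckerCoeff_rowLift_eq`** — for `|λ̄| ≤ m`: **`g(λ♯(m+j), (m+j)×d, (m+j)×d) = g(λ, m×d, m×d)`**
  for every `j` — IP Thm. 2.1 "`(n, d) ∈ St¹(ρ)` … which is true in particular if `n ≥ |ρ|`" / Manivel
  Thm. 1 "`k_ρ(d, n)` is constant for `d ≥ |ρ|`", now an equality in the tree.

Sources: C. Ikenmeyer, G. Panova, Adv. Math. 319 (2017) 40–66 = arXiv:1512.03798, Thm. 2.1 (held: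
Thm. 8) [key `IkenmeyerPanova2017`]; L. Manivel, J. Algebraic Combin. 33 (2011) 153–162, Thm. 1 and §1
(monotonicity) [key `Manivel2011`]; E. Vallejo, Electron. J. Combin. 6 (1999) R39 (stability of
Kronecker products).  Theorems only.
-/

noncomputable section

namespace Literature.Computability.Complexity

open Literature.NumberTheory.DiophantineGeometry

variable {m d : ℕ}

/-- A partition of `D` is a partition of any `D' = D` with the same parts. [folklore] -/
theorem exists_partition_parts_eq' {D D' : ℕ} (lam : Nat.Partition D) (h : D = D') :
    ∃ lam' : Nat.Partition D', lam'.parts = lam.parts := by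
  subst h
  exact ⟨lam, rfl⟩

/-- Partitions with the same parts have the same weight. [folklore] -/
theorem ofPartition_eq_of_parts_eq (N : ℕ) {D D' : ℕ} {lam : Nat.Partition D} {lam' : Nat.Partition D'}
    (h : lam.parts = lam'.parts) : Weight.ofPartition N lam = Weight.ofPartition N lam' := by
  funext i
  rw [Weight.ofPartition_apply, Weight.ofPartition_apply]
  simp only [Nat.Partition.sortedParts, h]

/-- **The next row lift is the previous one plus the one-row partition `(d)`** (in parts, transposed
orientation): if `L ⊢ d(m+j)` has the parts of `λ♯(m+j)`, then `λ♯(m+j+1)` has the parts of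
`L + (d·1)`. [folklore] -/
theorem parts_rowLift_succ_eq_rowAdd_indiscrete (lam : Nat.Partition (m * d)) (j : ℕ)
    (L : Nat.Partition (d * (m + j))) (hL : L.parts = (rowLift lam j).parts) :
    (rowLift lam (j + 1)).parts = (L.rowAdd (Nat.Partition.indiscrete (d * 1))).parts := by
  haveI : NeZero (lam.parts.card + 1) := ⟨Nat.succ_ne_zero _⟩
  have hc1 : (rowLift lam (j + 1)).parts.card ≤ lam.parts.card + 1 :=
    (card_parts_rowLift_le lam (j + 1)).trans (max_le (Nat.le_succ _) (by omega))
  have hcL : L.parts.card ≤ lam.parts.card + 1 := by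
    rw [hL]
    exact (card_parts_rowLift_le lam j).trans (max_le (Nat.le_succ _) (by omega))
  have hc2 : (L.rowAdd (Nat.Partition.indiscrete (d * 1))).parts.card ≤ lam.parts.card + 1 := by
    refine (card_parts_rowAdd_le L _).trans (max_le hcL ?_)
    rcases Nat.eq_zero_or_pos (d * 1) with h0 | hpos
    · rw [h0]; simp
    · rw [Nat.Partition.indiscrete_parts hpos.ne']; simp
  refine parts_eq_of_ofPartition_eq (N := lam.parts.card + 1) ?_ hc1 hc2
  rw [ofPartition_rowAdd, ofPartition_eq_of_parts_eq _ hL, ofPartition_rowLift, ofPartition_rowLift,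
    ofPartition_indiscrete, add_assoc, ← Pi.single_add]
  congr 2
  push_cast
  ring

/-- **Monotonicity of the Kronecker coefficients in `rowAdd` form** (`≤`-version of the semigroup
property `ikenmeyerPanova2017_semigroup_holds`): `g(λ, μ, ν) ≤ g(λ + λ', μ + μ', ν + ν')` whenever
`g(λ', μ', ν') > 0`. [cite: Manivel2011, §1 (monotonicity)] -/
theorem kroneckerCoeff_le_kroneckerCoeff_rowAdd {a b : ℕ} (lam mu nu : Nat.Partition a)
    (lam' mu' nu' : Nat.Partition b) (h' : 0 < kroneckerCoeff ℂ lam' mu' nu') :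
    kroneckerCoeff ℂ lam mu nu ≤ kroneckerCoeff ℂ (lam.rowAdd lam') (mu.rowAdd mu') (nu.rowAdd nu') := by
  have ha : ∀ ρ : Nat.Partition a, ρ.parts.card ≤ a + b := fun ρ =>
    ρ.card_parts_le_size.trans (Nat.le_add_right a b)
  have hb : ∀ ρ : Nat.Partition b, ρ.parts.card ≤ a + b := fun ρ =>
    ρ.card_parts_le_size.trans (Nat.le_add_left b a)
  have hab : ∀ (ρ : Nat.Partition a) (ρ' : Nat.Partition b), (ρ.rowAdd ρ').parts.card ≤ a + b :=
    fun ρ ρ' => (card_parts_rowAdd_le ρ ρ').trans (max_le (ha ρ) (hb ρ'))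
  exact kroneckerCoeff_le_of_ofPartition_add (k := ℂ) (a + b) (ha lam) (ha mu) (ha nu) (hb lam')
    (hb mu') (hb nu') (hab lam lam') (hab mu mu') (hab nu nu') (ofPartition_rowAdd _ lam lam')
    (ofPartition_rowAdd _ mu mu') (ofPartition_rowAdd _ nu nu') h'

/-- **Adding the one-row triple `((kM), k×M, k×M)` does not decrease `g`** (`≤`-version of
`kroneckerCoeff_pos_rowAdd_row`): `g(λ, k×b, k×b) ≤ g(λ + (kM), k×(b+M), k×(b+M))`.
[cite: IkenmeyerPanova2017, Lemma 4.2 (proof; held: Lemma 19, p. 9)] -/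
theorem kroneckerCoeff_le_rowAdd_row' {k b M : ℕ} (lam : Nat.Partition (k * b))
    (mu : Nat.Partition (k * (b + M)))
    (hmu : mu.parts = (lam.rowAdd (Nat.Partition.indiscrete (k * M))).parts) :
    kroneckerCoeff ℂ lam (Nat.Partition.rectangle k b) (Nat.Partition.rectangle k b) ≤
      kroneckerCoeff ℂ mu (Nat.Partition.rectangle k (b + M)) (Nat.Partition.rectangle k (b + M)) := by
  have h2 : 0 < kroneckerCoeff ℂ (Nat.Partition.indiscrete (k * M))
      (Nat.Partition.rectangle k M) (Nat.Partition.rectangle k M) :=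
    kroneckerCoeff_indiscrete_pos ℂ _
  have h3 := kroneckerCoeff_le_kroneckerCoeff_rowAdd lam (Nat.Partition.rectangle k b)
    (Nat.Partition.rectangle k b) _ _ _ h2
  have hp := rowAdd_rectangle_parts k b M
  rwa [kroneckerCoeff_congr_parts (Nat.mul_add k b M).symm (lam' := mu)
    (mu' := Nat.Partition.rectangle k (b + M)) (nu' := Nat.Partition.rectangle k (b + M)) hmu.symm
    hp hp] at h3

/-- **One stability step upwards, unconditionally**: for every `λ ⊢ m·d` and every `j`,
`g(λ♯(m+j), (m+j)×d, (m+j)×d) ≤ g(λ♯(m+j+1), (m+j+1)×d, (m+j+1)×d)` — transpose the rectangles to `d`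
rows (`kroneckerCoeff_rectangle_transpose`), add the positive one-row triple `((d), 1^d, 1^d)`, transpose
back.  (The companion `kroneckerCoeff_rowLift_succ_le` is the reverse inequality for `|λ̄| ≤ m`.)
[cite: Manivel2011, §1 (monotonicity) and Thm. 1] -/
theorem kroneckerCoeff_rowLift_succ_ge (lam : Nat.Partition (m * d)) (j : ℕ) :
    kroneckerCoeff ℂ (rowLift lam j) (Nat.Partition.rectangle (m + j) d) (Nat.Partition.rectangle (m + j) d) ≤
      kroneckerCoeff ℂ (rowLift lam (j + 1)) (Nat.Partition.rectangle (m + (j + 1)) d)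
        (Nat.Partition.rectangle (m + (j + 1)) d) := by
  obtain ⟨L, hL⟩ := exists_partition_parts_eq' (rowLift lam j) (Nat.mul_comm (m + j) d)
  obtain ⟨L1, hL1⟩ := exists_partition_parts_eq' (rowLift lam (j + 1))
    (show (m + (j + 1)) * d = d * (m + j + 1) by ring)
  rw [kroneckerCoeff_rectangle_transpose (rowLift lam j) L hL.symm,
    kroneckerCoeff_rectangle_transpose (rowLift lam (j + 1)) L1 hL1.symm]
  exact kroneckerCoeff_le_rowAdd_row' (k := d) (b := m + j) (M := 1) L L1
    (hL1.trans (parts_rowLift_succ_eq_rowAdd_indiscrete lam j L hL))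

/-- **The base is dominated along the whole ray, unconditionally**: for every `λ ⊢ m·d` and every `j`,
`g(λ, m×d, m×d) ≤ g(λ♯(m+j), (m+j)×d, (m+j)×d)`. [cite: Manivel2011, §1 (monotonicity)] -/
theorem kroneckerCoeff_le_kroneckerCoeff_rowLift (lam : Nat.Partition (m * d)) :
    ∀ j : ℕ, kroneckerCoeff ℂ lam (Nat.Partition.rectangle m d) (Nat.Partition.rectangle m d) ≤
      kroneckerCoeff ℂ (rowLift lam j) (Nat.Partition.rectangle (m + j) d) (Nat.Partition.rectangle (m + j) d)
  | 0 => (kroneckerCoeff_congr_parts (by ring) (lam' := rowLift lam 0) (mu' := Nat.Partition.rectangle (m + 0) d)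
      (nu' := Nat.Partition.rectangle (m + 0) d) (parts_rowLift_zero lam).symm rfl rfl).le
  | j + 1 => (kroneckerCoeff_le_kroneckerCoeff_rowLift lam j).trans (kroneckerCoeff_rowLift_succ_ge lam j)

/-- **IP Thm. 2.1 / Manivel Thm. 1 as an EQUALITY**: for `λ ⊢ m·d` with `|λ̄| ≤ m` and every `j`,
**`g(λ♯(m+j), (m+j)×d, (m+j)×d) = g(λ, m×d, m×d)`** — the ray of `λ` through the rectangular Kronecker
coefficients is CONSTANT from the start of the Manivel-stable range ("`(n, d) ∈ St¹(ρ)` … in particular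
if `n ≥ |ρ|`, we have that `g(ρ(nd), n×d, n×d)` [is the stable value]").  Upper half:
`kroneckerCoeff_rowLift_le`; lower half: `kroneckerCoeff_le_kroneckerCoeff_rowLift`.
[cite: IkenmeyerPanova2017, Thm. 2.1 (held: Thm. 8); Manivel2011, Thm. 1] -/
theorem kroneckerCoeff_rowLift_eq (lam : Nat.Partition (m * d)) (hbody : bodySize lam ≤ m) (j : ℕ) :
    kroneckerCoeff ℂ (rowLift lam j) (Nat.Partition.rectangle (m + j) d) (Nat.Partition.rectangle (m + j) d) =
      kroneckerCoeff ℂ lam (Nat.Partition.rectangle m d) (Nat.Partition.rectangle m d) :=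
  le_antisymm (kroneckerCoeff_rowLift_le lam hbody j) (kroneckerCoeff_le_kroneckerCoeff_rowLift lam j)

end Literature.Computability.Complexity
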